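import Literature.IUT.HodgeTheaters.GoodLocalFrobenioidOfGaloisDdash
import Literature.IUT.HodgeTheaters.GoodLocalFrobenioidOfPlaceCdashSplit
import Literature.IUT.HodgeTheaters.GoodLocalFrobenioidOfPlaceSlim
import Literature.IUT.HodgeTheaters.InitialThetaDataLocalSlim
import Literature.IUT.HodgeTheaters.PiAvatarBaseKitOfTorsionMonodromy
import Literature.IUT.HodgeTheaters.PiAvatarBaseKitProp65i
import Literature.IUT.HodgeTheaters.StableCurveTemperedDataOfSpecialFibreSec2A3TrichotomyProjections

/-!
# Kernel DAG index — layer X = MIXED delta (L5 ×6; one file per cycle under the live-queue discipline); 6 DISCHARGE SIBLINGS `N_<id>'` — rule DSIB-1 (abc-iut-dag GO 2026-08-27T19:22:42Z, guards (a)–(g)): for a DATA node of a claim-kind row marked discharged(p…) the sibling binds, BY NAME, the theorems of the lead-designated proof module(s) — the p-id(s) of that token — whose CONCLUSION HEAD is the node's typed statement def (farm scan, ProducersScan conclusion-head rule; FACT-minimal choice per def: assumption-free dischargers preferred, others enter only when none exists and then their F-ids are named; conjuncts without discharger are listed and NOT claimed). A conclusion-head match is a kernel fact about the TYPED statement; whether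 a discharger discharges the PRINTED item is the referees' and leads' word (RQ7/REF passes, NODES.md), not this file's. Append-only: the data node stays; dag re-keys col 21 to the primed name, part zg (GENERATED by abc-iut-c312-2 gen 9 `work/gen_index.py` @2026-08-28T05:13Z from HOME/plan/DAG.tsv +
KERNEL-DAG-MODULES.tsv (regenerated 2026-08-28T05:02:39Z): 6 landed/discharged nodes NOT YET in the tree index Summits/ABC/IUTFork/DAG*.lean; spec v1.3 §2 (M))

THIS FILE PROVES NOTHING NEW AND ASSERTS NOTHING (HOME/plan/KERNEL-DAG-SPEC.md). It gives ONE NAME `N_<kernel_id>` to each DAG node whose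
statement has LANDED through the gate, knitting the landed declarations BY NAME: claim nodes `N_<id> : Prop := StatementOf @thm₁ ∧ …` (one
conjunct per landed theorem the DAG row names, universe levels instantiated explicitly per the spec's UNIVERSE RULE, arities read off the farm),
witnessed `N_<id>_holds` iff the DAG row is `discharged(p…)` and `N_<id>_part` otherwise (spec §2(b),(c); c312-2 F1/F2); data nodes
`abbrev N_<id> := @<primary>` with the row's further declarations as `example := @…` lines; FACT-style `def … : Prop` declarations are data
here (a NAME, never asserted). Decl lists come from the `decls` column of plan/DAG.tsv as resolved against the tree sources (unresolvable
tokens dropped and reported to abc-iut-dag on STATUS). Nothing here says abc is proved or refuted or takes a side on [IUTchIII] Cor 3.12.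
typed ≠ discharged; indexed ≠ endorsed.
-/

namespace Summit.ABC.IUTFork.DAG

namespace PartXzg
/-- `StatementOf h` is the statement (a `Prop`) of which the landed `h` is the proof: the index NAMES statements, it never re-types them. -/
abbrev StatementOf {P : Prop} (_h : P) : Prop := P
end PartXzg
open PartXzg

noncomputable section
universe u₁ u₂ u₃ u₄ u₅ u₆ u₇ u₈ u₉ u₁₀ u₁₁ u₁₂ u₁₃ u₁₄ u₁₅ u₁₆


/-- [node IUTchI:Prop2.4(ii) · L5/D2 · [IUTchI] Prop 2.4 (ii), kurims p.50 · p506978 · claim · DAG status discharged(p506978+p517444+p496462)] decls 1 · DISCHARGE SIBLING of the data node `N_IUTchI_Prop2_4_ii` (which binds the item's typed STATEMENT def): this sibling binds the theorems of the lead-designated proof module(s) — the p-id(s) of the row's own discharged(…) token — whose CONCLUSION HEAD is that statement (farm scan, ProducersScan conclusion-head rule; STANDING RULE DSIB-S (abc-iut-dag g8 2026-08-28T02:18:32Z + erratum 02:18:49Z): the chair's one line = designation + no-strike; filed ≥ 30 min after it under the DSIB-1 guards (a)–(h); designation = abc-iut-L5-lead g12 RULINGS #277 (β) 2026-08-28T02:21:35Z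 (the #270 conjunction theorem `prop24_cor25_ofPiData_byName_noRF_frame_of_isFreeOrSurface_trichotomy` ★ p506978, component .1.2.1) + its named per-item form: abc-iut-dag g8 DSIB-S note 04:21:09Z «bind the ★ p604802 projection theorems whose conclusion heads are `Prop24ii` / `Prop24iii`» (filed ≥ 30 min after that note)); append-only; dag: kernel_id := `N_IUTchI_Prop2_4_ii'` · the item's OWN statement def(s): `Prop24ii` (own statement def `Prop24ii` (cell naming convention; L5-lead g12 RULINGS #277 (β) 02:21:35Z)) · discharger = `OfSpecialFibre.prop24ii_ofPiData_byName_noRF_frame_of_isFreeOrSurface_trichotomy` (★ p604802 `StableCurveTemperedDataOfSpecialFibreSec2A3TrichotomyProjections.lean`, abc-iut-L5-t11 g39 under L5 RULINGS #283 (F2): the PROOF-ONLY conjunct projection .1.2.1 of ★ p506978 at the identical datum, binders byte-identical, std3, aud-15 FAITHFUL-AS-LABELLED) — conclusion head `Prop24ii` at the genuine 𝔛-datum over `P`; CONDITIONAL on the displayed laws hNN_i · hab · hadm · hI_j^frame · hVc_j · hA3tri_j + (x′) (trichotomy and [SemiAnbd] Thm 5.4 (i) NOT proved — the record file's census); DAG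 main row stays discharged(p506978+p517444+p496462), p604802 joins the p-id column via INDEX-NAMES (dag 04:21:09Z); the meta-gadget route of my 03:15:17Z line is superseded by this landed projection · HONEST FRAMING: dischargers = OUR theorems about OUR typed statement, proved at our data / at a model where the designated module says so; discharged-at-our-data ≠ endorsed ≠ proved-in-print; census of record for the printed item = plan/L5/NODES.md; no side taken on [IUTchIII] Cor 3.12 · decl list as NAMED BY THE AUDITOR/LEAD (forced, not re-resolved) -/
abbrev N_IUTchI_Prop2_4_ii' : Prop := StatementOf @Literature.IUT.HodgeTheaters.StableCurveTemperedData.OfSpecialFibre.prop24ii_ofPiData_byName_noRF_frame_of_isFreeOrSurface_trichotomy.{u₁, u₂, u₃}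
/-- discharge of `N_IUTchI_Prop2_4_ii'`: the landed theorems it names, BY NAME (spec §2(c)); proves nothing new. -/
theorem N_IUTchI_Prop2_4_ii'_holds : N_IUTchI_Prop2_4_ii' := @Literature.IUT.HodgeTheaters.StableCurveTemperedData.OfSpecialFibre.prop24ii_ofPiData_byName_noRF_frame_of_isFreeOrSurface_trichotomy

/-- [node IUTchI:Prop2.4(iii) · L5/D2 · [IUTchI] Prop 2.4 (iii), kurims p.50 · p506978 · claim · DAG status discharged(p506978+p517444+p496462)] decls 1 · DISCHARGE SIBLING of the data node `N_IUTchI_Prop2_4_iii` (which binds the item's typed STATEMENT def): this sibling binds the theorems of the lead-designated proof module(s) — the p-id(s) of the row's own discharged(…) token — whose CONCLUSION HEAD is that statement (farm scan, ProducersScan conclusion-head rule; STANDING RULE DSIB-S (abc-iut-dag g8 2026-08-28T02:18:32Z + erratum 02:18:49Z): the chair's one line = designation + no-strike; filed ≥ 30 min after it under the DSIB-1 guards (a)–(h); designation = abc-iut-L5-lead g12 RULINGS #277 (β) 02:21:35Z (component .1.2.2 of ★ p506978) + abc-iut-dag g8 DSIB-S note 04:21:09Z (p604802 per-item head)); append-only;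 dag: kernel_id := `N_IUTchI_Prop2_4_iii'` · the item's OWN statement def(s): `Prop24iii` (own statement def `Prop24iii` (cell naming convention; L5 #277 (β))) · discharger = `OfSpecialFibre.prop24iii_ofPiData_byName_noRF_frame_of_isFreeOrSurface_trichotomy` (★ p604802, projection .1.2.2 of ★ p506978; same datum, binders and law census as the (ii) sibling); DAG main row stays discharged(p506978+p517444+p496462) · HONEST FRAMING: dischargers = OUR theorems about OUR typed statement, proved at our data / at a model where the designated module says so; discharged-at-our-data ≠ endorsed ≠ proved-in-print; census of record for the printed item = plan/L5/NODES.md; no side taken on [IUTchIII] Cor 3.12 · decl list as NAMED BY THE AUDITOR/LEAD (forced, not re-resolved) -/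
abbrev N_IUTchI_Prop2_4_iii' : Prop := StatementOf @Literature.IUT.HodgeTheaters.StableCurveTemperedData.OfSpecialFibre.prop24iii_ofPiData_byName_noRF_frame_of_isFreeOrSurface_trichotomy.{u₁, u₂, u₃}
/-- discharge of `N_IUTchI_Prop2_4_iii'`: the landed theorems it names, BY NAME (spec §2(c)); proves nothing new. -/
theorem N_IUTchI_Prop2_4_iii'_holds : N_IUTchI_Prop2_4_iii' := @Literature.IUT.HodgeTheaters.StableCurveTemperedData.OfSpecialFibre.prop24iii_ofPiData_byName_noRF_frame_of_isFreeOrSurface_trichotomy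

/-- [node IUTchI:Ex3.3(iii) · L5/D2 · [IUTchI] Ex 3.3 (iii), kurims p.77 · p405110 · claim · DAG status discharged(p405110+p489406+p490358+p490831)] decls 5 · DISCHARGE SIBLING of the data node `N_IUTchI_Ex3_3_iii` (which binds the item's typed STATEMENT def): this sibling binds the theorems of the lead-designated proof module(s) — the p-id(s) of the row's own discharged(…) token — whose CONCLUSION HEAD is that statement (farm scan, ProducersScan conclusion-head rule; STANDING RULE DSIB-S (abc-iut-dag g8 2026-08-28T02:18:32Z + erratum 02:18:49Z): the chair's one line = designation + no-strike; filed ≥ 30 min after it under the DSIB-1 guards (a)–(h); chair line abc-iut-L5-lead g13 RULINGS #287 (β1) 04:42:41Z «DSIB IUTchI:Ex3.3(iii): dischargers := ddashFromD_goodLocalFrobenioidAt_of_forall_map_ker @GoodLocalFrobenioidOfGaloisDdash · basesFromC_goodLocalFrobenioidAt @GoodLocalFrobenioidOfPlaceSlim · dFromF_goodLocalFrobenioidAt_of_geom_slim @InitialThetaDataLocalSlim · cdashFromF_goodLocalFrobenioidAt @GoodLocalFrobenioidOfPlaceCdashSplit · splitFromF_goodLocalFrobenioidAt_of_conj_autCongr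 @GoodLocalFrobenioidOfPlaceCdashSplit»); append-only; dag: kernel_id := `N_IUTchI_Ex3_3_iii'` · the item's OWN statement def(s): `DdashFromD`, `BasesFromC`, `DFromF`, `CdashFromF` (abc-iut-L5-lead g13 RULINGS #287 (β1) 2026-08-28T04:42:41Z: the five typed claims (a)–(e) of [IUTchI] Example 3.3 (iii) at the PLACE carrier `D.goodLocalFrobenioidAt w p hw hX`) · chair's reading (#287 (β1), carried): all five at the record's EXACT carrier `D.goodLocalFrobenioidAt w p hw hX` — they are the closers the record ★ p489406 (now p500506) `ex33iii_abcd_goodLocalFrobenioidAt` consumes BY NAME; binders DISPLAYED per clause: (a) hX · [SecondCountableTopology Π_{C_F}] · hΔ (= F-0007 shape) — p427236 l.266; (b) hX only — p419963 l.182; (c) hΔ : IsSlimGroup Δ_C (= F-0004₁) · hX — p420763 l.271; (d) hX · hΔC · hΔ · inst — p504713 l.74; (e) + DATA e : K̄_w ≃ₐ ℚ̄_p + hconj = GAP G-L5t16g8-1 in RAW conjugacy shape (the by-name spelling `AbsTopIII.ProfiniteAutOverGQp` exists only inside the conjunction head `ex33iii_goodLocalFrobenioidAt_byName` @p490831) —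 p504713 l.149; NOT designated: the six `GoodLocalFrobenioid.basesFromC_ofGalois*` heads (abstract Galois-datum functor, not the place functor); the sub row Ex3.3(iii)/e stays report-only (its record is the DECISION pair `not_splitFromF_ofKitQp` · `not_forall_splitFromF` — (e) REFUTED at the degenerate kit, positive only at the genuine place mod GAP; the positive (e) head rides HERE with the main row); FACT-shaped binders (F-0007 / F-0004 shapes) are displayed hypotheses — the K census will count them as typed (guard (f) labelling at the first census that scans this part) · HONEST FRAMING: dischargers = OUR theorems about OUR typed statement, proved at our data / at a model where the designated module says so; discharged-at-our-data ≠ endorsed ≠ proved-in-print; census of record for the printed item = plan/L5/NODES.md; no side taken on [IUTchIII] Cor 3.12 · decl list as NAMED BY THE AUDITOR/LEAD (forced, not re-resolved) · cites→ IUTchI:Ex3.2,IUTchI:Rmk3.1.2 -/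
def N_IUTchI_Ex3_3_iii' : Prop :=
  StatementOf @Literature.IUT.HodgeTheaters.InitialThetaData.ddashFromD_goodLocalFrobenioidAt_of_forall_map_ker.{u₁} ∧
  StatementOf @Literature.IUT.HodgeTheaters.InitialThetaData.basesFromC_goodLocalFrobenioidAt.{u₁} ∧
  StatementOf @Literature.IUT.HodgeTheaters.InitialThetaData.dFromF_goodLocalFrobenioidAt_of_geom_slim.{u₁} ∧
  StatementOf @Literature.IUT.HodgeTheaters.InitialThetaData.cdashFromF_goodLocalFrobenioidAt.{u₁} ∧
  StatementOf @Literature.IUT.HodgeTheaters.InitialThetaData.splitFromF_goodLocalFrobenioidAt_of_conj_autCongr.{u₁}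
/-- discharge of `N_IUTchI_Ex3_3_iii'`: the landed theorems it names, BY NAME (spec §2(c)); proves nothing new. -/
theorem N_IUTchI_Ex3_3_iii'_holds : N_IUTchI_Ex3_3_iii' := ⟨@Literature.IUT.HodgeTheaters.InitialThetaData.ddashFromD_goodLocalFrobenioidAt_of_forall_map_ker, @Literature.IUT.HodgeTheaters.InitialThetaData.basesFromC_goodLocalFrobenioidAt, @Literature.IUT.HodgeTheaters.InitialThetaData.dFromF_goodLocalFrobenioidAt_of_geom_slim, @Literature.IUT.HodgeTheaters.InitialThetaData.cdashFromF_goodLocalFrobenioidAt, @Literature.IUT.HodgeTheaters.InitialThetaData.splitFromF_goodLocalFrobenioidAt_of_conj_autCongr⟩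

/-- [node IUTchI:Prop6.6(ii) · L5/D2 · [IUTchI] Prop 6.6 (ii), kurims p.165 · p458154 · claim · DAG status discharged(p458154+p476399)] decls 1 · DISCHARGE SIBLING of the data node `N_IUTchI_Prop6_6_ii` (which binds the item's typed STATEMENT def): this sibling binds the theorems of the lead-designated proof module(s) — the p-id(s) of the row's own discharged(…) token — whose CONCLUSION HEAD is that statement (farm scan, ProducersScan conclusion-head rule; STANDING RULE DSIB-S (abc-iut-dag g8 2026-08-28T02:18:32Z + erratum 02:18:49Z): the chair's one line = designation + no-strike; filed ≥ 30 min after it under the DSIB-1 guards (a)–(h); chair line abc-iut-L5-lead g13 RULINGS #287 (β2) 04:42:41Z «DSIB IUTchI:Prop6.6(ii): dischargers := InitialThetaData.isoTorsor_thetaEllBridge_baseKitOfTorsionMonodromy @PiAvatarBaseKitOfTorsionMonodromy (p446463, l.81)»); append-only; dag: kernel_id := `N_IUTchI_Prop6_6_ii'` · conjuncts NOT covered (bound statement defs with no discharger in the designated module(s); nothing claimed about them): `GluingTorsor`, `ExtendsToHT` · the item's OWN statement def(s): `IsoTorsor` (abc-iut-L5-lead g13 #287 (β2): binds `PMBaseKit.DThetaEllBridge.IsoTorsor`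 ONLY (def PMBaseBridgeProps l.251–254)) · chair's reading (#287 (β2), carried): at the minimally-bound GENUINE §6 kit `D.baseKitOfTorsionMonodromy CG hS M hA hI B hsign ΛBad` (DATA CG · M · B, LAWS hS · hA · hI · hsign · ΛBad displayed); the record ★ p458154 `sec6_torsors_asPrinted_baseKitOfTorsionMonodromy_unramified` @PiAvatarBaseKitProp68iGroup is the SAME statement unfolded (def `IsoTorsor` verbatim) with hsign := `localArrowLaw_L2_sign_local` and the `Nonempty 𝕍 →` guard discharged; conjuncts NOT covered by design: the node's other bound defs `GluingTorsor` (= Prop 6.6 (iv)) and `ExtendsToHT` (= Prop 6.6 (v)) are data-node locator artefacts, NOT (ii) items ⇒ `DThetaEllBridge.extendsToHT` @PMBaseDischarge and `gluingTorsorF` @ThetaPMEllHodgeTheaters are NOT bound (binding either would put the wrong printed item under this node — the #285 error class); the abstract-kit forms `isoTorsor_of_negCompat[Model]` are genuine but redundant given the genuine-kit head — not bound · HONEST FRAMING: dischargers = OUR theorems about OUR typed statement, proved at our data / at a model where the designated module says so; discharged-at-our-data ≠ endorsed ≠ proved-in-print; census of record for the printed item = plan/L5/NODES.md; no side taken on [IUTchIII]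 Cor 3.12 · decl list as NAMED BY THE AUDITOR/LEAD (forced, not re-resolved) · cites→ IUTchI:Ex6.2 -/
abbrev N_IUTchI_Prop6_6_ii' : Prop := StatementOf @Literature.IUT.HodgeTheaters.InitialThetaData.isoTorsor_thetaEllBridge_baseKitOfTorsionMonodromy.{u₁, u₂, u₃}
/-- discharge of `N_IUTchI_Prop6_6_ii'`: the landed theorems it names, BY NAME (spec §2(c)); proves nothing new. -/
theorem N_IUTchI_Prop6_6_ii'_holds : N_IUTchI_Prop6_6_ii' := @Literature.IUT.HodgeTheaters.InitialThetaData.isoTorsor_thetaEllBridge_baseKitOfTorsionMonodromy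

/-- [node IUTchI:Prop6.6(iii) · L5/D2 · [IUTchI] Prop 6.6 (iii), kurims p.165 · p458154 · claim · DAG status discharged(p458154+p476399)] decls 1 · DISCHARGE SIBLING of the data node `N_IUTchI_Prop6_6_iii` (which binds the item's typed STATEMENT def): this sibling binds the theorems of the lead-designated proof module(s) — the p-id(s) of the row's own discharged(…) token — whose CONCLUSION HEAD is that statement (farm scan, ProducersScan conclusion-head rule; STANDING RULE DSIB-S (abc-iut-dag g8 2026-08-28T02:18:32Z + erratum 02:18:49Z): the chair's one line = designation + no-strike; filed ≥ 30 min after it under the DSIB-1 guards (a)–(h); chair line abc-iut-L5-lead g13 RULINGS #287 (β3) 04:42:41Z «DSIB IUTchI:Prop6.6(iii): dischargers := InitialThetaData.isoTorsor_thetaPMEllHT_baseKitOfTorsionMonodromy @PiAvatarBaseKitOfTorsionMonodromy (p446463, l.87)»); append-only; dag: kernel_id := `N_IUTchI_Prop6_6_iii'` · the item's OWN statement def(s): `IsoTorsor` (abc-iut-L5-lead g13 #287 (β3): binds `PMBaseKit.DThetaPMEllHT.IsoTorsor` ONLY (def PMBaseBridgeProps l.266–269) — NAMESPACE-EXACT (`PMBaseKit.DThetaPMBridge.IsoTorsor`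 l.230 is Prop 6.6 (i); `Glues` is (iv) machinery)) · chair's reading (#287 (β3), carried): same genuine §6 kit as the (ii) sibling; `DThetaPMBridge.isoTorsor` @PMBaseBridgePropsProofs (l.168, the Prop 6.6 (i) closer) must NOT be bound under (iii) and is not; the abstract-kit forms `DThetaPMEllHT.isoTorsor_of_negCompat[Model]` are redundant given the genuine-kit head — not bound · HONEST FRAMING: dischargers = OUR theorems about OUR typed statement, proved at our data / at a model where the designated module says so; discharged-at-our-data ≠ endorsed ≠ proved-in-print; census of record for the printed item = plan/L5/NODES.md; no side taken on [IUTchIII] Cor 3.12 · decl list as NAMED BY THE AUDITOR/LEAD (forced, not re-resolved) · cites→ IUTchI:Ex6.2 -/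
abbrev N_IUTchI_Prop6_6_iii' : Prop := StatementOf @Literature.IUT.HodgeTheaters.InitialThetaData.isoTorsor_thetaPMEllHT_baseKitOfTorsionMonodromy.{u₁, u₂, u₃}
/-- discharge of `N_IUTchI_Prop6_6_iii'`: the landed theorems it names, BY NAME (spec §2(c)); proves nothing new. -/
theorem N_IUTchI_Prop6_6_iii'_holds : N_IUTchI_Prop6_6_iii' := @Literature.IUT.HodgeTheaters.InitialThetaData.isoTorsor_thetaPMEllHT_baseKitOfTorsionMonodromy

/-- [node IUTchI:Prop6.5/P65-L07 · L5/ · p.164 l.3–12 · p407837 · claim · DAG status discharged(p407837)] decls 2 · DISCHARGE SIBLING of the data node `N_IUTchI_Prop6_5_P65_L07` (which binds the item's typed STATEMENT def): this sibling binds the theorems of the lead-designated proof module(s) — the p-id(s) of the row's own discharged(…) token — whose CONCLUSION HEAD is that statement (farm scan, ProducersScan conclusion-head rule; STANDING RULE DSIB-S (abc-iut-dag g8 2026-08-28T02:18:32Z + erratum 02:18:49Z): the chair's one line = designation + no-strike; filed ≥ 30 min after it under the DSIB-1 guards (a)–(h); chair line abc-iut-L5-lead g13 RULINGS #287 (β4)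 04:42:41Z «DSIB IUTchI:Prop6.5/P65-L07: dischargers := InitialThetaData.xiGroupCompat_baseKitOfTorsionMonodromy @PiAvatarBaseKitProp65i (p452410, l.147) · InitialThetaData.phiEllSync_baseKitOfTorsionMonodromy @PiAvatarBaseKitOfTorsionMonodromy (p446463, l.69)»); append-only; dag: kernel_id := `N_IUTchI_Prop6_5_P65_L07'` · the item's OWN statement def(s): `XiGroupCompat`, `PhiEllSync` (abc-iut-L5-lead g13 #287 (β4): sub row whose data node (DAGL5v l.174) binds `DThetaEllBridge.XiGroupCompat` + `Ex63.PhiEllSync`) · chair's reading (#287 (β4), carried): same genuine §6 kit as the Prop 6.6 (ii)/(iii) siblings; the `_baseKitOfData` / `_baseKitNFOfData` heads of the ELSEWHERE table are other kit carriers (data/NF-side stand-ins) — not bound · HONEST FRAMING: dischargers = OUR theorems about OUR typed statement, proved at our data / at a model where the designated module says so; discharged-at-our-data ≠ endorsed ≠ proved-in-print; census of record for the printed item = plan/L5/NODES.md; no side taken on [IUTchIII] Cor 3.12 · decl list as NAMED BY THE AUDITOR/LEAD (forced, not re-resolved) · cites→ P65-L02 `Ex63.PhiEllSync` BY NAME (audit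 R7-L5t4-F1: needed; kernel: `exists_kit_not_xiGroupCompat` shows the sentence FAILS over some kit satisfying every interface clause, so the law cannot be dropp -/
def N_IUTchI_Prop6_5_P65_L07' : Prop :=
  StatementOf @Literature.IUT.HodgeTheaters.InitialThetaData.xiGroupCompat_baseKitOfTorsionMonodromy.{u₁, u₂, u₃} ∧
  StatementOf @Literature.IUT.HodgeTheaters.InitialThetaData.phiEllSync_baseKitOfTorsionMonodromy.{u₁, u₂, u₃}
/-- discharge of `N_IUTchI_Prop6_5_P65_L07'`: the landed theorems it names, BY NAME (spec §2(c)); proves nothing new. -/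
theorem N_IUTchI_Prop6_5_P65_L07'_holds : N_IUTchI_Prop6_5_P65_L07' := ⟨@Literature.IUT.HodgeTheaters.InitialThetaData.xiGroupCompat_baseKitOfTorsionMonodromy, @Literature.IUT.HodgeTheaters.InitialThetaData.phiEllSync_baseKitOfTorsionMonodromy⟩

end

end Summit.ABC.IUTFork.DAG
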